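/-
Copyright (c) 2026 the pub-hodgecm-mathlib formalisation cell (harness21).  Prover seat hodgecm-mathlib-K2Liu-p10 (g7) (L1 hand placed on S8 by chair
K2-lead (g2) ACROSS-LINES VALVE 15 (i)), Track B ∕ K2-LIT, h413 = `stmt-HodgeConjecture-24833`, R90-TF section S8 «ContSpec-n½», the (M) «middle
residue» road, item (M-b) FACT-N LOCAL — its ALGEBRAIC half as a COROLLARY of (M-c) ORIENT (S8 dealer R90-CS-plan (g3), S8-R230 (1); census
2026-09-05T02:37Z).  THEOREMS ONLY (no `def`, no instance, no notation, no `sorry`).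
-/
import Literature.NumberTheory.Rogawski1990.U3PrincipalSeriesKeysOrientation   -- ★∕📤 the named fact `KeysOrientation` (this seat) over ★ `KeysCaseTwoLabels`, `Gqs`, `cmPrincipalSeries`, `cmXiTorusChar`
import Mathlib.RepresentationTheory.Intertwining                             -- `Representation.IntertwiningMap`, `.ker`, `.range`
import HarnessLib

/-!
# S8 (M) road, (M-b) FACT-N LOCAL — the ALGEBRAIC half from ORIENT: the kernel of ANY intertwining map out of `i_G(χ_ξ)` that is neither zero nor
# injective carries `π²(ξ_v)`, and the quotient by it carries `πⁿ(ξ_v)` (so «`ker N_v(3∕2) = π²`, `Im N_v(3∕2) ≅ πⁿ`» for the normalised local intertwining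
# operator at the residual point, once the global half delivers it as a non-zero, non-injective `G_v`-map)

Track B ∕ K2-LIT, crux h413 = `stmt-HodgeConjecture-24833`, route of record `HCCMUnconditional`; cell `hodgecm-mathlib`, R90-TF programme, section S8
«ContSpec-n½», the (M) «middle residue» road of socket B ED. 7 :299 (dealer R90-CS-plan (g3), S8-R230 (1); K2E1-p10 (g6) `CENSUS-RES-INT-Ma` lines 6–7:
«`ker M₋₁ = ker (⊗_v N_v(3∕2))`; FACT-N local: `N_v(3∕2)` holomorphic non-zero, `ker N_v = π²(ξ_v)`, `Im ≅ πⁿ(ξ_v)`»).  Lane `--supports stmt-HodgeConjecture-24833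
--as helper` (count-neutral).  CLOSES NO SOCKET.

CENSUS (2026-09-05T02:37Z, R90 bus).  The LOCAL letter FACT-N (M-b) has an ANALYTIC half — the normalised local intertwining FAMILY `N_v(z)` on
`I_v(χ_ξ, z)` is holomorphic and non-zero at `z = 3∕2` on `K_v`-finite flat sections — whose currency is the GLOBAL half's (`M(z) = m(z)·⊗_v N_v(z)` in the
K-finite scattering coordinates ★ `exists_kfinite_scatteringCoords_cm_three`; no local `U(3)_v` family exists in the tree: ★ `K2Lit.localIntertwining` is the
Siegel parabolic of the doubled group, and ★ `K2E1ChiIntertwiningLocalScalarU3` is the unramified spherical SCALAR, already holomorphic and explicit), and an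
ALGEBRAIC half — «`ker N_v(3∕2) = π²(ξ_v)`, `Im N_v(3∕2) ≅ πⁿ(ξ_v)`» — which is NOT a new fact: it follows from (M-c) ORIENT (★∕📤
`Literature.NumberTheory.Rogawski1990.KeysOrientation`, clause (iii): the ONLY proper non-zero `G`-stable subspace `K` of `i_G(χ_ξ)` carries `π²`, `i_G(χ_ξ) ⧸ K`
carries `πⁿ`) for ANY intertwining map `N` out of `i_G(χ_ξ)` with `⊥ ≠ ker N ≠ ⊤` (Mathlib `Representation.IntertwiningMap.ker : Subrepresentation`).  THIS FILE
proves that half, so the global half owes locally only «`N_v(3∕2)` is a non-zero, non-injective `G_v`-map out of `I_v(χ_ξ)`»: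

* §1 (generic, any monoid `G`, any intertwining map `N : ρ → σ`): `ker_ne_bot_of_not_injective`, `ker_ne_top_of_ne_zero` — the lattice spellings of «not
  injective» ∕ «not zero».
* §2 **`sub_quotient_of_keysOrientation`** — under `KeysOrientation L`, at the data of Keys' case (2) `(v, μ, η₁, η₂, μZ, πs, πn)` (★ `KeysCaseTwoLabels`, `πs` `L²`,
  `πn` not): every `G`-stable subspace `N` of `i_G(χ_ξ)` with `N ≠ ⊥`, `N ≠ ⊤` carries `π²(ξ_v)` (`∃ r, IrrClass.mk r = πs ∧ r.ρ ≃ N`) and `i_G(χ_ξ) ⧸ N` carries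
  `πⁿ(ξ_v)`; **`intertwiningMap_ker_quotient_of_keysOrientation`** — the same for `N := f.ker` of an intertwining map `f : i_G(χ_ξ) → σ` into any `ℂ[G_v]`-module
  with `¬ Injective f` and `f ≠ 0`.
The image `Im N ≅ i_G(χ_ξ) ⧸ ker N` (first isomorphism theorem) is left to the consumer in its own currency.  Elaboration: the CM carrier `Gqs L v` against the
matrix carrier of ★ `cmPrincipalSeries` costs ≈ 10⁶ heartbeats per statement (as ★ `F0P2pCmPrincipalSeriesInterface`; measured), hence the section options.
HONEST LABEL: every theorem here is CONDITIONAL on the UNPROVED letter `KeysOrientation`; the analytic half of FACT-N LOCAL stays a letter of the global half;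
HC_CM is proved only modulo the 7 printed citations (2 remaining named inputs: hLiu418 = `stmt-HodgeConjecture-24832`, h413 = `stmt-HodgeConjecture-24833`)
until rung 0 closes; REL ≠ ★ ≠ BUILT; count-neutral.

## References
* [Rogawski1990] J. D. Rogawski, Ann. of Math. Stud. 123 (1990), §11.4 p. 164 (Langlands quotients of `i_B(χ)`, `χ` positive), §12.2 (2) pp. 173–174,
  §12.3 (intertwining operators).
* [Keys1984] C. D. Keys, Compositio Math. 51 (1984) 115–130, §7.
* [MoeglinWaldspurger1995] C. Mœglin, J.-L. Waldspurger, *Spectral decomposition and Eisenstein series* (1995), II.1.6–II.1.7, IV.1.9 (`M(w, π)` and its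
  Euler factorisation).
* [BorelWallach2000] A. Borel, N. Wallach, 2nd ed. (2000), XI §2.
-/

set_option autoImplicit false
set_option linter.dupNamespace false  -- the mandated namespace `…HodgeConjecture.HodgeConjecture.R90.S8` repeats the summit's segment

noncomputable section

open NumberField IsDedekindDomain MeasureTheory
open Literature.NumberTheory Literature.NumberTheory.Automorphic Literature.NumberTheory.Rogawski1990

namespace Summit.HodgeConjecture.HodgeConjecture.R90.S8

/-! ## §1 Lattice spellings of «not injective» ∕ «not zero» for an intertwining map (generic) -/

section Generic

variable {A G V W : Type*} [CommRing A] [Monoid G] [AddCommGroup V] [Module A V] [AddCommGroup W] [Module A W]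
  {ρ : Representation A G V} {σ : Representation A G W}

/-- The kernel subrepresentation of a NON-INJECTIVE intertwining map is not `⊥` (Mathlib `LinearMap.ker_eq_bot`; `(⊥ : Subrepresentation ρ).toSubmodule = ⊥`
definitionally). [cite: BorelWallach2000, XI §2] -/
theorem ker_ne_bot_of_not_injective (N : ρ.IntertwiningMap σ) (h : ¬ Function.Injective N.toLinearMap) : N.ker ≠ ⊥ := by
  intro hk
  apply h
  have hk' : LinearMap.ker N.toLinearMap = ⊥ := congrArg Subrepresentation.toSubmodule hk
  exact LinearMap.ker_eq_bot.mp hk'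

/-- The kernel subrepresentation of a NON-ZERO intertwining map is not `⊤` (Mathlib `LinearMap.ker_eq_top`; `(⊤ : Subrepresentation ρ).toSubmodule = ⊤`
definitionally). [cite: BorelWallach2000, XI §2] -/
theorem ker_ne_top_of_ne_zero (N : ρ.IntertwiningMap σ) (h : N.toLinearMap ≠ 0) : N.ker ≠ ⊤ := by
  intro hk
  apply h
  have hk' : LinearMap.ker N.toLinearMap = ⊤ := congrArg Subrepresentation.toSubmodule hk
  exact LinearMap.ker_eq_top.mp hk'

end Generic

/-! ## §2 The kernel and the quotient of an intertwining map out of `i_G(χ_ξ)`, from ORIENT -/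

section Consumer

set_option synthInstance.maxHeartbeats 400000
set_option maxHeartbeats 4000000 -- section-local («measured», as ★ `F0P2pCmPrincipalSeriesInterface` ∕ ★∕📤 `R90S8KeysOrientationU3Statement`): the CM carrier `Gqs L v` vs the matrix carrier of ★ `cmPrincipalSeries` + `Representation.quotient`'s `≤`-binder cost ≈ 10⁶ heartbeats per statement

variable {L : Type} [Field L] [NumberField L] [IsCMField L]
  (h : KeysOrientation L) {v : HeightOneSpectrum (𝓞 ↥(maximalRealSubfield L))}
  (hns : ∀ w : UnitaryGroup.PlacesOver L v, IsCMField.complexConj L • w.1 = w.1)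
  {μ : (UnitaryGroup.LocalRing L v)ˣ →* ℂˣ}
  {η₁ η₂ : ↥(UnitaryGroup.normOneUnits (UnitaryGroup.conjLocal L (IsCMField.complexConj L) v)) →* ℂˣ}
  (hμ : UnitaryGroup.IsQuadraticCharExtension (UnitaryGroup.conjLocal L (IsCMField.complexConj L) v) μ)
  (hμc : Continuous (fun x => ((μ x : ℂˣ) : ℂ))) (h1c : Continuous (fun x => ((η₁ x : ℂˣ) : ℂ)))
  (h2c : Continuous (fun x => ((η₂ x : ℂˣ) : ℂ)))
  [MeasurableSpace (Gqs L v ⧸ Subgroup.center (Gqs L v))] [BorelSpace (Gqs L v ⧸ Subgroup.center (Gqs L v))]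
  (μZ : Measure (Gqs L v ⧸ Subgroup.center (Gqs L v))) [μZ.IsHaarMeasure]
  {πs πn : IrrClass (Gqs L v)} (hK : KeysCaseTwoLabels L v μ η₁ η₂ πs πn)
  (hs : πs.IsSquareIntegrable μZ) (hn : ¬ πn.IsSquareIntegrable μZ)

include h hns hμ hμc h1c h2c hK hs hn

/-- **EVERY PROPER NON-ZERO `G`-STABLE SUBSPACE OF `i_G(χ_ξ)` CARRIES `π²(ξ_v)`, AND THE QUOTIENT BY IT CARRIES `πⁿ(ξ_v)`** (ORIENT (iii) at the data:
the only proper non-zero `G`-stable subspace is the `π²`-subspace `K`, so `N = K`).  Apply it to `N := f.ker` of an intertwining map `f` out of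
`i_G(χ_ξ) = cmPrincipalSeries L 3 v (cmXiTorusChar L v μ η₁ η₂)` that is neither injective nor zero (§1): this is the algebraic half of «`ker N_v(3∕2) = π²(ξ_v)`,
`Im N_v(3∕2) ≅ i_G(χ_ξ) ⧸ ker ≅ πⁿ(ξ_v)`» for the normalised local intertwining operator at the residual point.
[cite: Rogawski1990, §11.4 p. 164; §12.2 (2) pp. 173–174; §12.3] [cite: Keys1984, §7] [cite: MoeglinWaldspurger1995, IV.1.9] -/
theorem sub_quotient_of_keysOrientation
    (N : Subrepresentation (UnitaryGroup.cmPrincipalSeries L 3 v (UnitaryGroup.cmXiTorusChar L v μ η₁ η₂)))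
    (hbot : N ≠ ⊥) (htop : N ≠ ⊤) :
    (∃ r : SmoothIrrep (Gqs L v), IrrClass.mk r = πs ∧ Nonempty (r.ρ.Equiv N.toRepresentation)) ∧
    (∃ r : SmoothIrrep (Gqs L v), IrrClass.mk r = πn ∧ Nonempty (r.ρ.Equiv
      ((UnitaryGroup.cmPrincipalSeries L 3 v (UnitaryGroup.cmXiTorusChar L v μ η₁ η₂)).quotient N.toSubmodule
        fun g _ hx => N.apply_mem_toSubmodule g hx))) := by
  obtain ⟨K, hlat, hKs, hKn⟩ := (h v hns μ η₁ η₂ hμ hμc h1c h2c μZ πs πn hK hs hn).2.2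
  rcases hlat N with hb | hk | ht
  · exact absurd hb hbot
  · subst hk
    exact ⟨hKs, hKn⟩
  · exact absurd ht htop

set_option maxHeartbeats 16000000 in -- the intertwining map's source type is re-elaborated through `Representation.IntertwiningMap` (implicit carrier ∕ instance arguments): matching it against the def's `Subrepresentation (cmPrincipalSeries …)` binder costs > 4·10⁶ (measured RED at 4·10⁶)
/-- **THE KERNEL OF AN INTERTWINING MAP OUT OF `i_G(χ_ξ)` THAT IS NEITHER INJECTIVE NOR ZERO CARRIES `π²(ξ_v)`, AND `i_G(χ_ξ) ⧸ ker` CARRIES `πⁿ(ξ_v)`**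
(`sub_quotient_of_keysOrientation` at `N := f.ker`, Mathlib `Representation.IntertwiningMap.ker`; §1 for the lattice spellings) — the shape in which the global
half of FACT-N delivers the residual-point operator `N_v(3∕2)`. [cite: Rogawski1990, §11.4 p. 164; §12.2 (2) pp. 173–174] [cite: Keys1984, §7] -/
theorem intertwiningMap_ker_quotient_of_keysOrientation {W : Type*} [AddCommGroup W] [Module ℂ W]
    {σ : Representation ℂ ↥(unitaryGroupOfForm (UnitaryGroup.conjLocal L (IsCMField.complexConj L) v) (UnitaryGroup.cmLocalForm L 3 v)) W}
    (f : (UnitaryGroup.cmPrincipalSeries L 3 v (UnitaryGroup.cmXiTorusChar L v μ η₁ η₂)).IntertwiningMap σ)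
    (hinj : ¬ Function.Injective f.toLinearMap) (h0 : f.toLinearMap ≠ 0) :
    (∃ r : SmoothIrrep (Gqs L v), IrrClass.mk r = πs ∧ Nonempty (r.ρ.Equiv f.ker.toRepresentation)) ∧
    (∃ r : SmoothIrrep (Gqs L v), IrrClass.mk r = πn ∧ Nonempty (r.ρ.Equiv
      ((UnitaryGroup.cmPrincipalSeries L 3 v (UnitaryGroup.cmXiTorusChar L v μ η₁ η₂)).quotient f.ker.toSubmodule
        fun g _ hx => f.ker.apply_mem_toSubmodule g hx))) :=
  sub_quotient_of_keysOrientation h hns hμ hμc h1c h2c μZ hK hs hn f.ker (ker_ne_bot_of_not_injective f hinj) (ker_ne_top_of_ne_zero f h0)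

end Consumer

end Summit.HodgeConjecture.HodgeConjecture.R90.S8

end
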